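import Summits.NavierStokesRegularity.FluidComputer.ClayBlowupSerrin
import Literature.Analysis.FluidPDE.VorticityEnstrophyGronwallForced
import HarnessLib

/-!
# BEALE–KATO–MAJDA AND CONSTANTIN–FEFFERMAN WITH THE CLAY FORCE: the vorticity rows of EVERY Clay
# blow-up (the (C) type), no `f = 0` hypothesis

Cell `ns-blowup`, seat `ns-blowup-ecbridge-2` (g9; the E–C endpoint theory seat). LABEL: E–C typing
(KERNEL — no named fact). WHAT THIS IS NOT: not Navier–Stokes evidence — necessary conditions on the
TYPE `ClayBlowup ν` (no inhabitant is claimed anywhere), hence — by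
`navierStokesBreakdownR3_iff_exists_nonempty_clayBlowup` — on every breakdown scenario for Fefferman's
(C). Companion memo: `run/shared/lean/pub/ns-blowup/ecbridge2/ECBRIDGE-2-MEMO-8.md`.

## Content

g8's `ClayBlowupVorticityCriteria.lean` carried the BKM and Constantin–Fefferman rows only for UNFORCED
inhabitants (`hf : X.f = 0`; the tree's discharges are unforced). The Literature file
`VorticityEnstrophyGronwallForced` proves the vorticity `L²` Grönwall bound WITH a force on every closed
slab; fed the type's Tao class, Clay-force slice bounds, ONE energy/dissipation bound and `H¹`
alternative (`not_exists_enstrophy_bound`), it gives for EVERY `X : ClayBlowup ν`, `ν > 0`: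

* **`ClayBlowup.lintegral_vorticity_sup_eq_top_forced`** — BEALE–KATO–MAJDA WITH THE CLAY FORCE:
  `∫₀ᵀ ‖curl u(t)‖_{L^∞} dt = ∞`;
* `ClayBlowup.vorticity_unbounded`, `exists_vorticity_gt_near` — the vorticity is unbounded on every
  `(t₀, T) × ℝ³`; **`ClayBlowup.not_subBKMRate`** — no rate `‖ω(t)‖_∞ ≤ C (T − t)^{−γ}` with `γ < 1`
  (the BKM floor: the vorticity maximum is not integrable in time at the lifespan);
* `ClayBlowup.lintegral_gradient_sup_eq_top_forced` — `∫₀ᵀ ‖∇u(t)‖_{L^∞} dt = ∞`;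
* **`ClayBlowup.vorticityDirection_incoherent_forced`** — CONSTANTIN–FEFFERMAN WITH THE CLAY FORCE:
  for every `Ω > 0`, `ρ > 0` some `t < T` and points `x, y` in `{|ω(t,·)| > Ω}` have
  `√(1 − ⟪ξ(t,x), ξ(t,y)⟫²) > |x − y|/ρ`;
* the `DesignedBlowup` twins and the (C)-reading `breakdownR3_vorticity`.

References: Beale–Kato–Majda 1984, Thm. 1 [cite: BealeKatoMajda1984, Theorem 1]; Majda–Bertozzi
2002, Thm. 3.6 [cite: MajdaBertozzi2002, Thm. 3.6 proof, (3.80)-(3.82)]; Constantin–Fefferman 1993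
[cite: ConstantinFeffermanIndiana1993, Theorem (§1)]; Fefferman (C) [cite: FeffermanClay2006, (C)];
Tao 2013, Lemma 8.1, Cor. 11.1 [cite: Tao2011, Lemma 8.1].
-/

noncomputable section

namespace Summit.NavierStokesRegularity.FluidComputer

open Set MeasureTheory Filter Topology Function Metric
open scoped ENNReal ContDiff NNReal RealInnerProductSpace
open Literature.Analysis.FluidPDE
open Summit.NavierStokesRegularity.NavierStokesRegularity

namespace ClayBlowup

variable {ν : ℝ} (X : ClayBlowup ν)

/-! ## §1 The curl of the Clay force, uniformly in `L²` -/

/-- **`∫|curl f(t)|² ≤ G` for all `t ≥ 0`** for the force of a Clay blow-up (Clay (5): the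
`H¹` slice bound of `force_iteratedFDeriv_slices` and `|curl f| ≤ ‖curl‖ |Df|`). [cite: FeffermanClay2006, (5)] -/
theorem exists_lintegral_curl_force_sq_le :
    ∃ G : ℝ≥0, ∀ t, 0 ≤ t → ∫⁻ x, ‖curl (X.f t) x‖ₑ ^ 2 ≤ G := by
  obtain ⟨C, hC⟩ := X.force_iteratedFDeriv_slices 1 le_rfl
  refine ⟨(‖curlCLM‖ ^ 2).toNNReal * C, fun t ht => ?_⟩
  refine (lintegral_curl_sq_le (X.f t)).trans ?_
  rw [ENNReal.coe_mul, ENNReal.ofReal]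
  exact mul_le_mul' le_rfl (hC t ht)

/-- The initial vorticity of a Clay blow-up has finite `L²` mass (`ν > 0`). [cite: Tao2011, Cor. 11.1] -/
theorem lintegral_curl_datum_sq_lt_top (hν : 0 < ν) : ∫⁻ x, ‖curl (X.u 0) x‖ₑ ^ 2 < ⊤ := by
  have hT := X.T_pos
  obtain ⟨D1, hD1⟩ := X.hasBoundedSobolevNormsOn hν (half_pos hT) (half_lt_self hT) 1
  exact (lintegral_curl_sq_le (X.u 0)).trans_lt
    (ENNReal.mul_lt_top ENNReal.ofReal_lt_top ((hD1 0 ⟨le_rfl, (half_pos hT).le⟩).trans_lt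
      ENNReal.coe_lt_top))

/-! ## §2 Beale–Kato–Majda with the Clay force -/

/-- **BKM finiteness ⇒ uniform enstrophy bound on `[0, T)`, for ANY Clay blow-up** (`ν > 0`; no
`f = 0` hypothesis, no named fact): if `A = ∫₀ᵀ ‖curl u(t)‖_{L^∞} dt < ∞` then
`∫|∇u(s)|² ≤ (∫|curl u(0)|² + G T) exp(2A + T)` for every `s < T` — the Literature theorem
`lintegral_frobeniusNormSq_le_of_vorticity_sup_forced` on each closed sub-slab `[0, s]` (Tao class
there), the right-hand side being monotone in `s`. [cite: BealeKatoMajda1984, Theorem 1]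
[cite: MajdaBertozzi2002, Thm. 3.6 proof, (3.80)-(3.82)] -/
theorem enstrophy_le_of_vorticity_sup (hν : 0 < ν)
    (hA : ∫⁻ t in Ioo 0 X.T, (⨆ x, ‖curl (X.u t) x‖ₑ) ≠ ⊤) :
    ∃ B : ℝ≥0, ∀ s ∈ Ico 0 X.T, ∫⁻ x, ENNReal.ofReal (frobeniusNormSq (fderiv ℝ (X.u s) x)) ≤ B := by
  have hT := X.T_pos
  obtain ⟨G, hG⟩ := X.exists_lintegral_curl_force_sq_le
  set A : ℝ≥0∞ := ∫⁻ t in Ioo 0 X.T, (⨆ x, ‖curl (X.u t) x‖ₑ) with hAdef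
  set Y₀ : ℝ := ∫ x, ‖curl (X.u 0) x‖ ^ 2 with hY₀
  have hY₀0 : 0 ≤ Y₀ := integral_nonneg fun x => sq_nonneg _
  set Bound : ℝ≥0∞ := ENNReal.ofReal ((Y₀ + G * X.T) * Real.exp (2 * A.toReal + X.T)) with hBound
  set D₀ : ℝ≥0∞ := ∫⁻ x, ENNReal.ofReal (frobeniusNormSq (fderiv ℝ (X.u 0) x)) with hD₀
  have hD₀top : D₀ < ⊤ := by
    obtain ⟨D1, hD1⟩ := X.hasBoundedSobolevNormsOn hν (half_pos hT) (half_lt_self hT) 1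
    exact (lintegral_frobeniusNormSq_le_three_mul_iteratedFDeriv_one (X.u 0)).trans_lt
      (ENNReal.mul_lt_top (by simp) ((hD1 0 ⟨le_rfl, (half_pos hT).le⟩).trans_lt ENNReal.coe_lt_top))
  have htop : Bound + D₀ ≠ ⊤ := ENNReal.add_ne_top.2 ⟨ENNReal.ofReal_ne_top, hD₀top.ne⟩
  refine ⟨(Bound + D₀).toNNReal, fun s hs => ?_⟩
  rw [ENNReal.coe_toNNReal htop]
  rcases eq_or_lt_of_le hs.1 with h0 | hs0
  · rw [← h0]; exact le_add_self
  · refine le_trans ?_ le_self_add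
    have hcl := X.classical_Icc hs0 hs.2
    have hB := X.hasBoundedSobolevNormsOn hν hs0 hs.2
    have hGs : ∀ t ∈ Icc 0 s, ∫⁻ x, ‖curl (X.f t) x‖ₑ ^ 2 ≤ G := fun t ht => hG t ht.1
    have hsub : Ioo 0 s ⊆ Ioo 0 X.T := Ioo_subset_Ioo le_rfl hs.2.le
    have hAs : ∫⁻ t in Ioo 0 s, (⨆ x, ‖curl (X.u t) x‖ₑ) ≤ A := lintegral_mono_set hsub
    have hAs_top : ∫⁻ t in Ioo 0 s, (⨆ x, ‖curl (X.u t) x‖ₑ) ≠ ⊤ := ne_top_of_le_ne_top hA hAs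
    have h := lintegral_frobeniusNormSq_le_of_vorticity_sup_forced hν hs0 hcl hB hGs hAs_top s
      ⟨hs0.le, le_rfl⟩
    refine h.trans (ENNReal.ofReal_le_ofReal ?_)
    have h1 : (G : ℝ) * s ≤ G * X.T := mul_le_mul_of_nonneg_left hs.2.le G.coe_nonneg
    have h2 : 2 * (∫⁻ t in Ioo 0 s, ⨆ x, ‖curl (X.u t) x‖ₑ).toReal + s ≤ 2 * A.toReal + X.T := by
      have := ENNReal.toReal_mono hA hAs
      linarith [hs.2]
    exact mul_le_mul (by linarith) (Real.exp_le_exp.2 h2) (Real.exp_pos _).le (by positivity)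

/-- **BEALE–KATO–MAJDA WITH THE CLAY FORCE, FOR EVERY CLAY BLOW-UP** (`ν > 0`; no `f = 0`
hypothesis, no named fact): `∫₀ᵀ ‖curl u(t)‖_{L^∞} dt = ∞` (lower Lebesgue integral of the
`ℝ≥0∞`-valued spatial supremum). The `H¹` alternative `not_exists_enstrophy_bound` closes the
argument. Supersedes the unforced row `lintegral_vorticity_sup_eq_top` of
`ClayBlowupVorticityCriteria`. [cite: BealeKatoMajda1984, Theorem 1] [cite: MajdaBertozzi2002, Thm. 3.6 proof, (3.80)-(3.82)] -/
theorem lintegral_vorticity_sup_eq_top_forced (hν : 0 < ν) :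
    (∫⁻ t in Ioo 0 X.T, ⨆ x, ‖curl (X.u t) x‖ₑ) = ⊤ := by
  by_contra hA
  obtain ⟨B, hB⟩ := X.enstrophy_le_of_vorticity_sup hν hA
  exact X.not_exists_enstrophy_bound hν ⟨B, hB⟩

/-- **The vorticity of a Clay blow-up is NOT bounded on `[0, T) × ℝ³`** (`ν > 0`, any Clay force):
a bound `M` would make `∫₀ᵀ ‖curl u‖_∞ ≤ M T` finite. [cite: BealeKatoMajda1984, Theorem 1] -/
theorem vorticity_unbounded (hν : 0 < ν) :
    ¬ ∃ M : ℝ, ∀ t ∈ Ico 0 X.T, ∀ x, ‖curl (X.u t) x‖ ≤ M := by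
  rintro ⟨M, hM⟩
  have htop := X.lintegral_vorticity_sup_eq_top_forced hν
  have hle : (∫⁻ t in Ioo 0 X.T, ⨆ x, ‖curl (X.u t) x‖ₑ) ≤ ∫⁻ _ in Ioo 0 X.T, ENNReal.ofReal M := by
    refine setLIntegral_mono' measurableSet_Ioo fun t ht => iSup_le fun x => ?_
    rw [← ofReal_norm]
    exact ENNReal.ofReal_le_ofReal (hM t ⟨ht.1.le, ht.2⟩ x)
  rw [setLIntegral_const, Real.volume_Ioo, sub_zero, htop, top_le_iff] at hle
  exact ENNReal.mul_ne_top ENNReal.ofReal_ne_top ENNReal.ofReal_ne_top hle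

/-- **For every bound `M` some point of `[0, T) × ℝ³` has `|curl u| > M`.**
[cite: BealeKatoMajda1984, Theorem 1] -/
theorem exists_vorticity_gt (hν : 0 < ν) (M : ℝ) :
    ∃ t ∈ Ico 0 X.T, ∃ x, M < ‖curl (X.u t) x‖ := by
  by_contra h
  exact X.vorticity_unbounded hν ⟨M, fun t ht x => not_lt.1 fun hlt => h ⟨t, ht, x, hlt⟩⟩

/-- **The vorticity blows up AT `T`**: for every `t₀ < T` and every `M` some `(t, x)` with
`t₀ < t < T` has `|curl u(t, x)| > M` (on `[0, t₀]` the Tao class bounds `|∇u|`, hence `|curl u|`).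
[cite: BealeKatoMajda1984, Theorem 1] [cite: Tao2011, Cor. 11.1] -/
theorem exists_vorticity_gt_near (hν : 0 < ν) {t₀ : ℝ} (ht₀ : t₀ < X.T) (M : ℝ) :
    ∃ t ∈ Ioo t₀ X.T, ∃ x, M < ‖curl (X.u t) x‖ := by
  have hT := X.T_pos
  -- a bound on `[0, max t₀ (T/2)]`
  set t₁ : ℝ := max t₀ (X.T / 2) with ht₁
  have ht₁0 : 0 < t₁ := lt_max_of_lt_right (half_pos hT)
  have ht₁T : t₁ < X.T := max_lt ht₀ (half_lt_self hT)
  have hB := X.hasBoundedSobolevNormsOn hν ht₁0 ht₁T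
  obtain ⟨B₁, -, hB₁⟩ := exists_forall_norm_fderiv_le_of_hasBoundedSobolevNormsOn
    (fun t ht => ((X.classical_Icc ht₁0 ht₁T).contDiff_velocity ht).of_le (by norm_cast)) hB
  obtain ⟨t, ht, x, hx⟩ := X.exists_vorticity_gt hν (max M (‖curlCLM‖ * B₁))
  rcases le_or_gt t t₁ with htt₁ | htt₁
  · have htI : t ∈ Icc 0 t₁ := ⟨ht.1, htt₁⟩
    have h1 : ‖curl (X.u t) x‖ ≤ ‖curlCLM‖ * B₁ :=
      (norm_curl_le (X.u t) x).trans (mul_le_mul_of_nonneg_left (hB₁ t htI x) (norm_nonneg curlCLM))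
    exact absurd ((le_max_right M _).trans_lt hx) (not_lt.2 h1)
  · exact ⟨t, ⟨(le_max_left _ _).trans_lt htt₁, ht.2⟩, x, (le_max_left M _).trans_lt hx⟩

/-- **THE BKM FLOOR FOR EVERY CLAY BLOW-UP: no integrable rate for the vorticity maximum** (`ν > 0`,
any Clay force; no named fact): there are no `C ≥ 0` and `γ < 1` with `|curl u(t, x)| ≤ C (T − t)^{−γ}`
on `(0, T) × ℝ³` — the integral `∫₀ᵀ ‖curl u‖_∞` would converge. The self-similar / Type-I vorticity
rate `(T − t)^{−1}` is the borderline. [cite: BealeKatoMajda1984, Theorem 1 and Corollary] -/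
theorem not_subBKMRate (hν : 0 < ν) {C γ : ℝ} (hC : 0 ≤ C) (hγ : γ < 1)
    (hrate : ∀ t ∈ Ioo 0 X.T, ∀ x, ‖curl (X.u t) x‖ ≤ C * (X.T - t) ^ (-γ)) : False := by
  have htop := X.lintegral_vorticity_sup_eq_top_forced hν
  have hγe : γ * 1 < 1 := by rw [mul_one]; exact hγ
  have hfin := DesignedBlowup.lintegral_ofReal_rate_rpow_lt_top (γ := γ) X.T_pos hC hγe
  have hle : (∫⁻ t in Ioo 0 X.T, ⨆ x, ‖curl (X.u t) x‖ₑ) ≤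
      ∫⁻ t in Ioo 0 X.T, ENNReal.ofReal ((C * (X.T - t) ^ (-γ)) ^ (1 : ℝ)) := by
    refine setLIntegral_mono' measurableSet_Ioo fun t ht => iSup_le fun x => ?_
    rw [← ofReal_norm, Real.rpow_one]
    exact ENNReal.ofReal_le_ofReal (hrate t ht x)
  exact absurd (htop ▸ hle) (not_le.2 hfin)

/-- **`∫₀ᵀ ‖∇u(t)‖_{L^∞} dt = ∞` for every Clay blow-up** (`ν > 0`, any Clay force; the gradient
form of BKM, Majda–Bertozzi 2002, (3.79)–(3.82)): `|curl u| ≤ ‖curl‖ |∇u|` pointwise.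
[cite: MajdaBertozzi2002, Thm. 3.6 proof, (3.80)-(3.82)] -/
theorem lintegral_gradient_sup_eq_top_forced (hν : 0 < ν) :
    (∫⁻ t in Ioo 0 X.T, ⨆ x, ‖fderiv ℝ (X.u t) x‖ₑ) = ⊤ := by
  by_contra hne
  have htop := X.lintegral_vorticity_sup_eq_top_forced hν
  have hle : (∫⁻ t in Ioo 0 X.T, ⨆ x, ‖curl (X.u t) x‖ₑ) ≤
      ENNReal.ofReal ‖curlCLM‖ * ∫⁻ t in Ioo 0 X.T, ⨆ x, ‖fderiv ℝ (X.u t) x‖ₑ := by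
    rw [← lintegral_const_mul' _ _ ENNReal.ofReal_ne_top]
    refine lintegral_mono fun t => iSup_le fun x => ?_
    rw [← ofReal_norm]
    calc ENNReal.ofReal ‖curl (X.u t) x‖ ≤ ENNReal.ofReal (‖curlCLM‖ * ‖fderiv ℝ (X.u t) x‖) :=
          ENNReal.ofReal_le_ofReal (norm_curl_le (X.u t) x)
      _ = ENNReal.ofReal ‖curlCLM‖ * ENNReal.ofReal ‖fderiv ℝ (X.u t) x‖ :=
          ENNReal.ofReal_mul (norm_nonneg curlCLM)
      _ ≤ ENNReal.ofReal ‖curlCLM‖ * ⨆ y, ENNReal.ofReal ‖fderiv ℝ (X.u t) y‖ :=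
          mul_le_mul' le_rfl (le_iSup (fun y => ENNReal.ofReal ‖fderiv ℝ (X.u t) y‖) x)
      _ = ENNReal.ofReal ‖curlCLM‖ * ⨆ y, ‖fderiv ℝ (X.u t) y‖ₑ := by
          congr 1
          exact iSup_congr fun y => ofReal_norm _
  rw [htop, top_le_iff] at hle
  exact ENNReal.mul_ne_top ENNReal.ofReal_ne_top hne hle

/-! ## §3 Constantin–Fefferman with the Clay force -/

set_option maxHeartbeats 800000 in
/-- **Direction coherence ⇒ uniform enstrophy bound on `[0, T)`, for ANY Clay blow-up** (`ν > 0`;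
no `f = 0` hypothesis, no named fact): under Constantin–Fefferman's hypothesis
`√(1 − ⟪ξ(t,x), ξ(t,y)⟫²) ≤ |x − y|/ρ` on `{|ω(t,·)| > Ω}` for all `t < T`, the enstrophy is bounded on
`[0, T)` — the Literature theorem `sq_norm_curl_le_of_direction_slab_forced` on each closed sub-slab
`[0, s]` with the purely spatial stretching estimate `exists_two_mul_integral_stretching_le`, the type's
ONE energy/dissipation bound and the Clay-force slice bound; the right-hand side is monotone in `s`.
[cite: ConstantinFeffermanIndiana1993, Theorem (§1)] [cite: Tao2011, Lemma 8.1] -/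
theorem enstrophy_le_of_direction (hν : 0 < ν) {Ω ρ : ℝ} (hΩ : 0 < Ω) (hρ : 0 < ρ)
    (hdir : ∀ t ∈ Ico 0 X.T, ∀ x y : EuclideanSpace ℝ (Fin 3),
      Ω < ‖curl (X.u t) x‖ → Ω < ‖curl (X.u t) y‖ →
        Real.sqrt (1 - inner ℝ (vorticityDirection (curl (X.u t)) x)
          (vorticityDirection (curl (X.u t)) y) ^ 2) ≤ ‖x - y‖ / ρ) :
    ∃ B : ℝ≥0, ∀ s ∈ Ico 0 X.T, ∫⁻ x, ENNReal.ofReal (frobeniusNormSq (fderiv ℝ (X.u s) x)) ≤ B := by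
  have hT := X.T_pos
  obtain ⟨G, hG⟩ := X.exists_lintegral_curl_force_sq_le
  obtain ⟨C₁, C₂, C₃, C₄, hC₁, hC₂, hC₃, hC₄, hstr⟩ := exists_two_mul_integral_stretching_le hν hΩ hρ
  obtain ⟨E, hEt, hEn, hdis⟩ := X.energy_dissipation_le hν
  have hν' : ENNReal.ofReal ν ≠ 0 := (ENNReal.ofReal_pos.2 hν).ne'
  set Ē : ℝ := E.toReal with hĒ
  have hĒ0 : 0 ≤ Ē := ENNReal.toReal_nonneg
  set I : ℝ := (E / ENNReal.ofReal ν).toReal with hIdef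
  have hI0 : 0 ≤ I := ENNReal.toReal_nonneg
  have hdissT : ∫⁻ t in Ioo 0 X.T, ∫⁻ x, ENNReal.ofReal (frobeniusNormSq (fderiv ℝ (X.u t) x)) ≤
      ENNReal.ofReal I := by
    have h1 : ∫⁻ t in Ioo 0 X.T, ∫⁻ x, ENNReal.ofReal (frobeniusNormSq (fderiv ℝ (X.u t) x)) ≤
        E / ENNReal.ofReal ν := by
      rw [ENNReal.le_div_iff_mul_le (Or.inl hν') (Or.inl ENNReal.ofReal_ne_top), mul_comm]
      exact hdis
    refine h1.trans (le_of_eq ?_)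
    rw [hIdef, ENNReal.ofReal_toReal]
    exact (ENNReal.div_lt_top hEt.ne hν').ne
  set Y₀ : ℝ := ∫ x, ‖curl (X.u 0) x‖ ^ 2 with hY₀
  have hY₀0 : 0 ≤ Y₀ := integral_nonneg fun x => sq_nonneg _
  set Ystar : ℝ := (Y₀ + C₄ * I + G * X.T) *
    Real.exp ((C₁ + C₃ * Ē + 1) * X.T + C₂ * (‖curlCLM‖ ^ 2 * I)) with hYstar
  have hYstar0 : 0 ≤ Ystar := by positivity
  set D₀ : ℝ≥0∞ := ∫⁻ x, ENNReal.ofReal (frobeniusNormSq (fderiv ℝ (X.u 0) x)) with hD₀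
  have hD₀top : D₀ < ⊤ := by
    obtain ⟨D1, hD1⟩ := X.hasBoundedSobolevNormsOn hν (half_pos hT) (half_lt_self hT) 1
    exact (lintegral_frobeniusNormSq_le_three_mul_iteratedFDeriv_one (X.u 0)).trans_lt
      (ENNReal.mul_lt_top (by simp) ((hD1 0 ⟨le_rfl, (half_pos hT).le⟩).trans_lt ENNReal.coe_lt_top))
  have htop : ENNReal.ofReal Ystar + D₀ ≠ ⊤ := ENNReal.add_ne_top.2 ⟨ENNReal.ofReal_ne_top, hD₀top.ne⟩
  refine ⟨(ENNReal.ofReal Ystar + D₀).toNNReal, fun s hs => ?_⟩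
  rw [ENNReal.coe_toNNReal htop]
  rcases eq_or_lt_of_le hs.1 with h0 | hs0
  · rw [← h0]; exact le_add_self
  refine le_trans ?_ le_self_add
  -- the closed slab `[0, s]`
  have hS := X.classical_Icc hs0 hs.2
  have hB := X.hasBoundedSobolevNormsOn hν hs0 hs.2
  have hGs : ∀ t ∈ Icc 0 s, ∫⁻ x, ‖curl (X.f t) x‖ₑ ^ 2 ≤ G := fun t ht => hG t ht.1
  have hen' : ∀ t ∈ Icc 0 s, ∫⁻ x, ‖X.u t x‖ₑ ^ 2 ≤ ENNReal.ofReal Ē := fun t ht => by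
    rw [hĒ, ENNReal.ofReal_toReal hEt.ne]
    exact hEn t ⟨ht.1, ht.2.trans_lt hs.2⟩
  have hdiss' : ∫⁻ t in Ioo 0 s, ∫⁻ x, ENNReal.ofReal (frobeniusNormSq (fderiv ℝ (X.u t) x)) ≤
      ENNReal.ofReal I := (lintegral_mono_set (Ioo_subset_Ioo le_rfl hs.2.le)).trans hdissT
  -- the stretching estimate on the slab
  have hstrS : ∀ t ∈ Icc 0 s,
      2 * ∫ x, inner ℝ (curl (X.u t) x) (fderiv ℝ (X.u t) x (curl (X.u t) x)) ≤
        ν * (∫ x, frobeniusNormSq (fderiv ℝ (curl (X.u t)) x)) +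
          (C₁ + C₂ * (∫ x, ‖curl (X.u t) x‖ ^ 2) + C₃ * (∫ x, ‖X.u t x‖ ^ 2)) *
            (∫ x, ‖curl (X.u t) x‖ ^ 2) +
          C₄ * (∫ x, frobeniusNormSq (fderiv ℝ (X.u t) x)) := by
    intro t ht
    have htT : t ∈ Ico 0 X.T := ⟨ht.1, ht.2.trans_lt hs.2⟩
    have hv : ContDiff ℝ ∞ (X.u t) := hS.contDiff_velocity ht
    have hv4 : ContDiff ℝ 4 (X.u t) := hv.of_le (by norm_cast)
    have hv2 : ContDiff ℝ 2 (X.u t) := hv.of_le (by norm_cast)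
    have hfin : ∀ n, ∫⁻ x, ‖iteratedFDeriv ℝ n (X.u t) x‖ₑ ^ 2 < ⊤ := fun n => by
      obtain ⟨Cn, hCn⟩ := hB n
      exact (hCn t ht).trans_lt ENNReal.coe_lt_top
    have i0 : Integrable fun x => ‖X.u t x‖ ^ 2 :=
      integrable_sq_norm_of_lintegral_lt_top hv.continuous ((hen' t ht).trans_lt ENNReal.ofReal_lt_top)
    have i1 : Integrable fun x => ‖fderiv ℝ (X.u t) x‖ ^ 2 := by
      have h := integrable_sq_norm_of_lintegral_lt_top (hv4.continuous_iteratedFDeriv (by norm_num))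
        (hfin 1)
      exact h.congr (Eventually.of_forall fun x => by simp only [norm_iteratedFDeriv_one])
    have i2 : Integrable fun x => ‖fderiv ℝ (fderiv ℝ (X.u t)) x‖ ^ 2 := by
      have h := integrable_sq_norm_of_lintegral_lt_top (hv4.continuous_iteratedFDeriv (by norm_num))
        (hfin 2)
      refine h.congr (Eventually.of_forall fun x => ?_)
      show ‖iteratedFDeriv ℝ 2 (X.u t) x‖ ^ 2 = ‖fderiv ℝ (fderiv ℝ (X.u t)) x‖ ^ 2
      rw [← norm_iteratedFDeriv_fderiv, norm_iteratedFDeriv_one]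
    obtain ⟨B₂, -, hB₂⟩ := exists_forall_norm_fderiv_fderiv_le_of_hasBoundedSobolevNormsOn
      (fun r hr => (hS.contDiff_velocity hr).of_le (by norm_cast)) hB
    exact hstr hv2 (hS.divFree t ht) i0 i1 i2 ⟨B₂, hB₂ t ht⟩ (hdir t htT)
  have hY := sq_norm_curl_le_of_direction_slab_forced hν hs0 hS hB hGs hĒ0 hI0 hen' hdiss'
    hC₁ hC₂ hC₃ hC₄ hstrS s ⟨hs0.le, le_rfl⟩
  have hYstar_le : ∫ x, ‖curl (X.u s) x‖ ^ 2 ≤ Ystar := by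
    refine hY.trans ?_
    rw [hYstar]
    have h1 : (G : ℝ) * s ≤ G * X.T := mul_le_mul_of_nonneg_left hs.2.le G.coe_nonneg
    have h2 : (C₁ + C₃ * Ē + 1) * s ≤ (C₁ + C₃ * Ē + 1) * X.T :=
      mul_le_mul_of_nonneg_left hs.2.le (by positivity)
    exact mul_le_mul (by linarith) (Real.exp_le_exp.2 (by linarith)) (Real.exp_pos _).le
      (by positivity)
  -- `∫|∇u(s)|² ≤ ∫|ω(s)|² ≤ Ystar`
  have hsS : s ∈ Icc 0 s := ⟨hs0.le, le_rfl⟩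
  have hvs : ContDiff ℝ ∞ (X.u s) := hS.contDiff_velocity hsS
  have hcurl_int : Integrable fun x => ‖curl (X.u s) x‖ ^ 2 := by
    have hfin1 : ∫⁻ x, ‖iteratedFDeriv ℝ 1 (X.u s) x‖ₑ ^ 2 < ⊤ := by
      obtain ⟨C1, hC1⟩ := hB 1
      exact (hC1 s hsS).trans_lt ENNReal.coe_lt_top
    refine integrable_sq_norm_of_lintegral_lt_top (continuous_curl (hvs.of_le (by norm_cast))) ?_
    exact lt_of_le_of_lt (lintegral_curl_sq_le (X.u s)) (ENNReal.mul_lt_top ENNReal.ofReal_lt_top hfin1)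
  refine (lintegral_frobeniusNormSq_fderiv_le_lintegral_sq_norm_curl (hvs.of_le (by norm_cast))
    (hS.divFree s hsS) ((hen' s hsS).trans_lt ENNReal.ofReal_lt_top)).trans ?_
  rw [show (∫⁻ x, ‖curl (X.u s) x‖ₑ ^ 2) = ∫⁻ x, ENNReal.ofReal (‖curl (X.u s) x‖ ^ 2) from
    lintegral_congr fun x => by rw [← ofReal_norm, ENNReal.ofReal_pow (norm_nonneg _)],
    ← ofReal_integral_eq_lintegral_ofReal hcurl_int (Eventually.of_forall fun x => sq_nonneg _)]
  exact ENNReal.ofReal_le_ofReal hYstar_le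

/-- **CONSTANTIN–FEFFERMAN WITH THE CLAY FORCE, FOR EVERY CLAY BLOW-UP: the vorticity direction is
incoherent in the high-vorticity region** (`ν > 0`; no `f = 0` hypothesis, no named fact). For every
`Ω > 0` and `ρ > 0` there are `t ∈ [0, T)` and points `x, y` with `|ω(t, x)| > Ω`, `|ω(t, y)| > Ω` and
`√(1 − ⟪ξ(t,x), ξ(t,y)⟫²) > |x − y|/ρ`, `ξ = ω/|ω|` (`vorticityDirection`). Supersedes the unforced row
`vorticityDirection_incoherent` of `ClayBlowupVorticityCriteria`.
[cite: ConstantinFeffermanIndiana1993, Theorem (§1)] -/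
theorem vorticityDirection_incoherent_forced (hν : 0 < ν) {Ω ρ : ℝ} (hΩ : 0 < Ω) (hρ : 0 < ρ) :
    ∃ t ∈ Ico 0 X.T, ∃ x y : EuclideanSpace ℝ (Fin 3),
      Ω < ‖curl (X.u t) x‖ ∧ Ω < ‖curl (X.u t) y‖ ∧
        ‖x - y‖ / ρ <
          Real.sqrt (1 - inner ℝ (vorticityDirection (curl (X.u t)) x)
            (vorticityDirection (curl (X.u t)) y) ^ 2) := by
  by_contra h
  push Not at h
  obtain ⟨B, hB⟩ := X.enstrophy_le_of_direction hν hΩ hρ fun t ht x y hx hy => h t ht x y hx hy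
  exact X.not_exists_enstrophy_bound hν ⟨B, hB⟩

end ClayBlowup

/-! ## §4 The strong type and the Clay statement -/

namespace DesignedBlowup

variable {ν : ℝ} (D : DesignedBlowup ν)

/-- **Beale–Kato–Majda with the Clay force for every designed blow-up.**
[cite: BealeKatoMajda1984, Theorem 1] -/
theorem lintegral_vorticity_sup_eq_top_forced (hν : 0 < ν) :
    (∫⁻ t in Ioo 0 D.T, ⨆ x, ‖curl (D.u t) x‖ₑ) = ⊤ :=
  D.toClayBlowup.lintegral_vorticity_sup_eq_top_forced hν

/-- **The BKM floor for every designed blow-up**: no `|curl u(t,x)| ≤ C (T − t)^{−γ}` with `γ < 1`.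
[cite: BealeKatoMajda1984, Theorem 1 and Corollary] -/
theorem not_subBKMRate (hν : 0 < ν) {C γ : ℝ} (hC : 0 ≤ C) (hγ : γ < 1)
    (hrate : ∀ t ∈ Ioo 0 D.T, ∀ x, ‖curl (D.u t) x‖ ≤ C * (D.T - t) ^ (-γ)) : False :=
  D.toClayBlowup.not_subBKMRate hν hC hγ hrate

/-- **Constantin–Fefferman with the Clay force for every designed blow-up.**
[cite: ConstantinFeffermanIndiana1993, Theorem (§1)] -/
theorem vorticityDirection_incoherent_forced (hν : 0 < ν) {Ω ρ : ℝ} (hΩ : 0 < Ω) (hρ : 0 < ρ) :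
    ∃ t ∈ Ico 0 D.T, ∃ x y : EuclideanSpace ℝ (Fin 3),
      Ω < ‖curl (D.u t) x‖ ∧ Ω < ‖curl (D.u t) y‖ ∧
        ‖x - y‖ / ρ <
          Real.sqrt (1 - inner ℝ (vorticityDirection (curl (D.u t)) x)
            (vorticityDirection (curl (D.u t)) y) ^ 2) :=
  D.toClayBlowup.vorticityDirection_incoherent_forced hν hΩ hρ

end DesignedBlowup

/-- **EVERY BREAKDOWN SCENARIO FOR (C) HAS NON-INTEGRABLE VORTICITY MAXIMUM AND INCOHERENT VORTICITY
DIRECTIONS** (no named fact): if Fefferman's (C) holds then at every `ν > 0` there is a Clay blow-up —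
a classical finite-energy forced evolution of a Clay datum under a Clay force with finite lifespan `T` —
with `∫₀ᵀ ‖curl u(t)‖_∞ dt = ∞`, no vorticity rate `C (T − t)^{−γ}`, `γ < 1`, and, for every `Ω, ρ > 0`,
points of `{|ω| > Ω}` where the vorticity directions fail the `ρ⁻¹`-Lipschitz sine condition.
[cite: FeffermanClay2006, (C)] [cite: BealeKatoMajda1984, Theorem 1] [cite: ConstantinFeffermanIndiana1993, Theorem (§1)] -/
theorem breakdownR3_vorticity
    (h : Summit.NavierStokesRegularity.NavierStokesRegularity.NavierStokesBreakdownR3)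
    {ν : ℝ} (hν : 0 < ν) :
    ∃ X : ClayBlowup ν,
      (∫⁻ t in Ioo 0 X.T, ⨆ x, ‖curl (X.u t) x‖ₑ) = ⊤ ∧
      (∀ C γ : ℝ, 0 ≤ C → γ < 1 →
        ¬ ∀ t ∈ Ioo 0 X.T, ∀ x, ‖curl (X.u t) x‖ ≤ C * (X.T - t) ^ (-γ)) ∧
      ∀ Ω ρ : ℝ, 0 < Ω → 0 < ρ →
        ∃ t ∈ Ico 0 X.T, ∃ x y : EuclideanSpace ℝ (Fin 3),
          Ω < ‖curl (X.u t) x‖ ∧ Ω < ‖curl (X.u t) y‖ ∧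
            ‖x - y‖ / ρ <
              Real.sqrt (1 - inner ℝ (vorticityDirection (curl (X.u t)) x)
                (vorticityDirection (curl (X.u t)) y) ^ 2) := by
  obtain ⟨X⟩ := forall_nonempty_clayBlowup_of_breakdownR3 h ν hν
  exact ⟨X, X.lintegral_vorticity_sup_eq_top_forced hν,
    fun C γ hC hγ hrate => X.not_subBKMRate hν hC hγ hrate,
    fun Ω ρ hΩ hρ => X.vorticityDirection_incoherent_forced hν hΩ hρ⟩

end Summit.NavierStokesRegularity.FluidComputer

end
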